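import Summits.KontsevichZagierPeriods.KontsevichZagierPeriods.Theorems.RootDecompQuadraticDescentPair18HomotopyAngP18

/-! # `RootDecompQuadraticDescentPair18HomotopyAngP19` — part 19/20 of the mechanical ≤400-line split of `Pair18HomotopyAng_v13_landing.lean` (sha256 01bf0af4c8d09f43…)
Source: decomp-kz lens-6 g9 `Pair18HomotopyAng.lean` v13 (HOME/decomp-kz-lens-6/g9/, sha256 bd7fcda1…; critic g5 19:35:56Z CLEARED «angle side of #18 PROVED»: hTh7_holds, hB17_holds, hAng4_holds with no hypotheses) — companion file #2 of Pair18Homotopy v14 (landed as …Pair18HomotopyP01–P31): the verbatim COPIED PRELUDE is dropped in favour of those landed declarations, the four homonyms with different bodies are renamed (Th7_eq', TriA, isSemialgebraic_TriA, volume_diag'), `#print axioms` pins removed.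
Split by census-1 g9 `gen/splitlean.py`: scopes re-opened with their `open`/`variable`/`set_option` context; mathematics and declaration order unchanged. -/

set_option linter.unusedSimpArgs false
noncomputable section
open _root_.Set MvPolynomial
namespace Summit.KontsevichZagierPeriods.RootDecompQuadraticDescent.Pair18Homotopy
open Literature.NumberTheory.Transcendental
open Literature.NumberTheory.Transcendental.KZ (RFun cube)
open Summit.KontsevichZagierPeriods.RootDecompQuadraticDescent.DarkPairs (rel_reflect_rep rel_double)
section Fold
open Literature.ModelTheory.ExponentialFields (IsSemialgebraic isSemialgebraic_setOf_eval_le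
  isSemialgebraic_setOf_eval_pos isSemialgebraic_setOf_eval_nonneg isSemialgebraic_setOf_eval_eq_zero)

open _root_.Set MvPolynomial in
open Literature.NumberTheory.Transcendental in
open Literature.NumberTheory.Transcendental.KZ (RFun cube) in
open Summit.KontsevichZagierPeriods.RootDecompQuadraticDescent.DarkPairs (rel_reflect_rep rel_double) in
open Literature.ModelTheory.ExponentialFields (IsSemialgebraic isSemialgebraic_setOf_eval_le isSemialgebraic_setOf_eval_pos isSemialgebraic_setOf_eval_nonneg isSemialgebraic_setOf_eval_eq_zero) in
/-- Auxiliary step `volume_edge0` (§19u): volume edge0. [bookkeeping] -/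
private theorem volume_edge0 : MeasureTheory.volume {z : Fin 2 → ℝ | z 0 = 0} = 0 := by
  have h := volume_setOf_aeval_eq_zero (k := ℚ) (m := 2) (X 0 : MvPolynomial (Fin 2) ℚ) (by
    rw [MvPolynomial.map_X]; exact MvPolynomial.X_ne_zero 0)
  have e : {x : Fin 2 → ℝ | aeval x (X 0 : MvPolynomial (Fin 2) ℚ) = 0} = {z | z 0 = 0} := by
    ext z; simp only [mem_setOf_eq, aeval_X]
  rw [e] at h; exact h

open _root_.Set MvPolynomial in
open Literature.NumberTheory.Transcendental in
open Literature.NumberTheory.Transcendental.KZ (RFun cube) in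
open Summit.KontsevichZagierPeriods.RootDecompQuadraticDescent.DarkPairs (rel_reflect_rep rel_double) in
open Literature.ModelTheory.ExponentialFields (IsSemialgebraic isSemialgebraic_setOf_eval_le isSemialgebraic_setOf_eval_pos isSemialgebraic_setOf_eval_nonneg isSemialgebraic_setOf_eval_eq_zero) in
/-- Auxiliary step `h7q` (§19u): h7q. [bookkeeping] -/
private theorem h7q : (0:ℚ) ≤ 7 := by norm_num

open _root_.Set MvPolynomial in
open Literature.NumberTheory.Transcendental in
open Literature.NumberTheory.Transcendental.KZ (RFun cube) in
open Summit.KontsevichZagierPeriods.RootDecompQuadraticDescent.DarkPairs (rel_reflect_rep rel_double) in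
/-- Auxiliary step `vec2_1` (§2b): vec2 1. [bookkeeping] -/
private theorem vec2_1 (a b : ℝ) : (![a, b] : Fin 2 → ℝ) 1 = b := rfl

open _root_.Set MvPolynomial in
open Literature.NumberTheory.Transcendental in
open Literature.NumberTheory.Transcendental.KZ (RFun cube) in
open Summit.KontsevichZagierPeriods.RootDecompQuadraticDescent.DarkPairs (rel_reflect_rep rel_double) in
/-- Auxiliary step `vec2_0` (§2b): vec2 0. [bookkeeping] -/
private theorem vec2_0 (a b : ℝ) : (![a, b] : Fin 2 → ℝ) 0 = a := rfl

open _root_.Set MvPolynomial in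
open Literature.NumberTheory.Transcendental in
open Literature.NumberTheory.Transcendental.KZ (RFun cube) in
open Summit.KontsevichZagierPeriods.RootDecompQuadraticDescent.DarkPairs (rel_reflect_rep rel_double) in
/-- Auxiliary step `cube2` (§0): cube2. [bookkeeping] -/
private theorem cube2 {x : Fin 2 → ℝ} (hx : x ∈ KZ.cube 2) : (0 ≤ x 0 ∧ x 0 ≤ 1) ∧ (0 ≤ x 1 ∧ x 1 ≤ 1) := ⟨hx 0, hx 1⟩

/-- `[2W₇ | TriA] ≡ 2•[W₇ | TriA]`, `[W₇|□] ≡ [W₇|TriA] + [W₇|TriUp]`, `[W₇|TriUp] ≡ [W₇|TriA]`. -/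
theorem W14Tri_twice : KZ.of W14Tri - KZ.of W7Tri - KZ.of W7Tri ∈ KZ.relations :=
  KZ.integrandAddRel_subset_relations ⟨2, W14Tri, W7Tri, W7Tri, rfl, rfl, fun z _ => by
    simp only [W14Tri, W7Tri, KZ.IntegralRep.integrand_restrict, RFun.rep_integrand, Pi.add_apply]
    simp only [W14, W7, RFun.fn, aeval_C, eq_ratCast, Rat.cast_ofNat]
    ring, rfl⟩
/-- Auxiliary step `W7cube_diag`: W7cube diag. [bookkeeping] -/
theorem W7cube_diag : KZ.of W7cube - KZ.of W7Tri - KZ.of W7TriUp ∈ KZ.relations :=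
  rel_cut W7cube W7Tri W7TriUp (fun z => z 1 - z 0) 0 rfl rfl volume_diag' (fun _ _ => rfl) (fun _ _ => rfl)
/-- Auxiliary step `W7TriUp_Tri`: W7 Tri Up Tri. [bookkeeping] -/
theorem W7TriUp_Tri : KZ.of W7TriUp - KZ.of W7Tri ∈ KZ.relations := by
  refine W7_swap isSemialgebraic_TriUp isSemialgebraic_TriA (fun _ hz => hz.1) (fun _ hz => hz.1)
    (fun z hz => ?_) (fun w hw => ?_)
  · obtain ⟨hcu, hd⟩ := hz
    have h0 := (cube2 hcu).1
    have h1 := (cube2 hcu).2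
    have hd' : 0 ≤ z 1 - z 0 := hd
    refine ⟨?_, ?_⟩
    · intro i
      fin_cases i
      · exact h1
      · exact h0
    · show Sw z 1 - Sw z 0 ≤ 0
      rw [Sw_zero, Sw_one]; linarith
  · obtain ⟨hcu, hd⟩ := hw
    have h0 := (cube2 hcu).1
    have h1 := (cube2 hcu).2
    have hd' : w 1 - w 0 ≤ 0 := hd
    refine ⟨?_, ?_⟩
    · intro i
      fin_cases i
      · exact h1
      · exact h0
    · show 0 ≤ Sw w 1 - Sw w 0
      rw [Sw_zero, Sw_one]; linarith

/-- **hTh7**: `[Th7] ≡ [W₇ | [0,1]²]` — `θ² = ∫∫_□ 7/((1+7y)(1+7yx²)) = ∫∫_□ 7/((1+7x²)(1+7y²))`. -/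
theorem hTh7_holds : KZ.of Th7.rep - KZ.of W7cube ∈ KZ.relations := by
  have h := sub_mem (sub_mem (add_mem (sub_mem (add_mem (add_mem (neg_mem (Bq_Bbox 7 h7q)) Bq7_P) BqP_cov)
    W14Tri_P) W14Tri_twice) W7cube_diag) W7TriUp_Tri
  rw [Th7_eq']
  convert h using 1
  abel

/-- **hAng4 ⟸ hB17 alone**: the angle side of #18 follows from the single cube→chart identity
`[B17] ≡ [W₇|[0,1/7]²]` (`B(1/7) = α₁²`; g10: the three steps of §19u for `U = 1/7` + the linear scaling `×7`). -/
theorem hAng4_of_B17 (hB17 : KZ.of B17.rep - KZ.of W7Sq17 ∈ KZ.relations) :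
    KZ.of AngHM + KZ.of AngHp + KZ.of AngHm - KZ.of Th7.rep + 2 • KZ.of B17.rep ∈ KZ.relations :=
  hAng4_of_X0 hTh7_holds hB17

/-! ### §19v  hB17 — `[B17] ≡ [W₇|[0,1/7]²]`: the `U = 1/7` copy of §19u followed by the linear scaling `(x,y) ↦ (x/7, y/7)`.
With it the whole angle side of #18 is UNCONDITIONAL: `hAng4_holds`. -/

/-- Auxiliary step `h17q` (§19v): h17q. [bookkeeping] -/
theorem h17q : (0:ℚ) ≤ 1 / 7 := by norm_num
/-- Auxiliary step `B17_eq` (§19v): B17 eq. [bookkeeping] -/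
theorem B17_eq : B17.rep = (Bbox (1 / 7) h17q).rep := rfl
/-- Auxiliary definition `W27Den` (§19v): W27 Den. [bookkeeping] -/
def W27Den : MvPolynomial (Fin 2) ℚ := (C 1 + C (1 / 7) * X 0 * X 0) * (C 1 + C (1 / 7) * X 1 * X 1)
/-- Auxiliary step `W27Den_pos` (§19v): W27 Den pos. [bookkeeping] -/
theorem W27Den_pos (x : Fin 2 → ℝ) : 0 < aeval x W27Den := by
  simp only [W27Den, map_add, map_mul, aeval_C, aeval_X, eq_ratCast, Rat.cast_one, Rat.cast_ofNat, Rat.cast_div]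
  have ha : (0:ℝ) < 1 + 1 / 7 * x 0 * x 0 := by nlinarith [mul_self_nonneg (x 0)]
  have hb : (0:ℝ) < 1 + 1 / 7 * x 1 * x 1 := by nlinarith [mul_self_nonneg (x 1)]
  positivity
/-- `W_{2/7} = [□², (2/7)/((1+x²/7)(1+y²/7))]`. -/
def W27 : RFun 2 := ⟨C (2 / 7), W27Den, fun x _ => (W27Den_pos x).ne'⟩
/-- Auxiliary definition `Tri17` (§19v): Tri17. [bookkeeping] -/
def Tri17 : Set (Fin 2 → ℝ) := Sq17 ∩ sDiag
/-- Auxiliary definition `TriUp17` (§19v): Tri Up17. [bookkeeping] -/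
def TriUp17 : Set (Fin 2 → ℝ) := Sq17 ∩ sDiagU
/-- Auxiliary step `isSemialgebraic_Tri17` (§19v): is Semialgebraic Tri17. [bookkeeping] -/
theorem isSemialgebraic_Tri17 : IsSemialgebraic ℚ Tri17 := isSemialgebraic_Sq17.inter isSemialgebraic_sDiag
/-- Auxiliary step `isSemialgebraic_TriUp17` (§19v): is Semialgebraic Tri Up17. [bookkeeping] -/
theorem isSemialgebraic_TriUp17 : IsSemialgebraic ℚ TriUp17 := isSemialgebraic_Sq17.inter isSemialgebraic_sDiagU
/-- Auxiliary definition `Bq17P` (§19v): Bq17 P. [bookkeeping] -/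
def Bq17P : KZ.IntegralRep 2 := (Bq (1 / 7) h17q).rep.restrict SqP0 isSemialgebraic_SqP0 (fun _ hz => hz.1)
/-- Auxiliary definition `W27Tri` (§19v): W27 Tri. [bookkeeping] -/
def W27Tri : KZ.IntegralRep 2 := W27.rep.restrict TriA isSemialgebraic_TriA (fun _ hz => hz.1)
/-- Auxiliary definition `W27TriP` (§19v): W27 Tri P. [bookkeeping] -/
def W27TriP : KZ.IntegralRep 2 := W27Tri.restrict TriP isSemialgebraic_TriP (fun _ hz => hz.1)
/-- Auxiliary definition `W14Tri17` (§19v): W14 Tri17. [bookkeeping] -/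
def W14Tri17 : KZ.IntegralRep 2 := W14.rep.restrict Tri17 isSemialgebraic_Tri17 (fun _ hz => hz.1.1)
/-- Auxiliary definition `W7Tri17` (§19v): W7 Tri17. [bookkeeping] -/
def W7Tri17 : KZ.IntegralRep 2 := W7.rep.restrict Tri17 isSemialgebraic_Tri17 (fun _ hz => hz.1.1)
/-- Auxiliary definition `W7TriUp17` (§19v): W7 Tri Up17. [bookkeeping] -/
def W7TriUp17 : KZ.IntegralRep 2 := W7.rep.restrict TriUp17 isSemialgebraic_TriUp17 (fun _ hz => hz.1.1)

/-- Auxiliary step `Bq17_P` (§19v): Bq17 P. [bookkeeping] -/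
theorem Bq17_P : KZ.of (Bq (1 / 7) h17q).rep - KZ.of Bq17P ∈ KZ.relations := by
  refine rel_restrict_null (Bq (1 / 7) h17q).rep SqP0 isSemialgebraic_SqP0 (fun _ hz => hz.1)
    (MeasureTheory.measure_mono_null (fun z hz => ?_) volume_edge0)
  obtain ⟨hzc, hzn⟩ := hz
  have hzc' : z ∈ cube 2 := hzc
  have h0 := (cube2 hzc').1
  simp only [mem_setOf_eq]
  by_contra hne
  exact hzn ⟨hzc', lt_of_le_of_ne h0.1 (Ne.symm hne)⟩
/-- Auxiliary step `W27Tri_P` (§19v): W27 Tri P. [bookkeeping] -/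
theorem W27Tri_P : KZ.of W27Tri - KZ.of W27TriP ∈ KZ.relations := by
  refine rel_restrict_null W27Tri TriP isSemialgebraic_TriP (fun _ hz => hz.1)
    (MeasureTheory.measure_mono_null (fun z hz => ?_) volume_edge0)
  obtain ⟨hzc, hzn⟩ := hz
  have hzc' : z ∈ TriA := hzc
  have h0 := (cube2 hzc'.1).1
  simp only [mem_setOf_eq]
  by_contra hne
  exact hzn ⟨hzc', lt_of_le_of_ne h0.1 (Ne.symm hne)⟩

set_option maxHeartbeats 800000 in
/-- the fibre cov for `U = 1/7`: `[Bq (1/7) | v > 0] ≡ [W_{2/7} | 0 ≤ t ≤ v, v > 0]`. -/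
theorem Bq17P_cov : KZ.of Bq17P - KZ.of W27TriP ∈ KZ.relations := by
  let Mz : (Fin 2 → ℝ) → Matrix (Fin 2) (Fin 2) ℝ := fun z => !![1, 0; z 1, z 0]
  let Φ' : (Fin 2 → ℝ) → (Fin 2 → ℝ) →L[ℝ] (Fin 2 → ℝ) := fun z =>
    LinearMap.toContinuousLinearMap (Matrix.toLin' (Mz z))
  have hΦ'ap : ∀ z w, Φ' z w = ![w 0, z 1 * w 0 + z 0 * w 1] := by
    intro z w; funext i
    fin_cases i <;> simp [Φ', Mz, Matrix.toLin'_apply, Matrix.mulVec, dotProduct, Fin.sum_univ_two]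
  have hdet : ∀ z, (Φ' z).det = z 0 := by
    intro z
    unfold ContinuousLinearMap.det
    simp [Φ', LinearMap.det_toLin', Mz, Matrix.det_fin_two]
  have hdom : W27TriP.domain = Fib '' Bq17P.domain := by
    simp only [W27TriP, Bq17P, KZ.IntegralRep.domain_restrict]
    ext w
    constructor
    · rintro ⟨⟨hwc, hle⟩, hpos⟩
      have h0 := (cube2 hwc).1
      have h1 := (cube2 hwc).2
      have hle' : w 1 - w 0 ≤ 0 := hle
      have hpos' : 0 < w 0 := hpos
      refine ⟨![w 0, w 1 / w 0], ⟨?_, ?_⟩, ?_⟩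
      · intro i
        fin_cases i
        · exact h0
        · show 0 ≤ w 1 / w 0 ∧ w 1 / w 0 ≤ 1
          exact ⟨div_nonneg h1.1 h0.1, by rw [div_le_one hpos']; linarith⟩
      · show (0:ℝ) < w 0
        exact hpos'
      · funext i
        fin_cases i
        · rfl
        · show w 0 * (w 1 / w 0) = w 1
          field_simp
    · rintro ⟨z, ⟨hzc, hpos⟩, rfl⟩
      have h0 := (cube2 hzc).1
      have h1 := (cube2 hzc).2
      have hpos' : 0 < z 0 := hpos
      refine ⟨⟨?_, ?_⟩, ?_⟩
      · intro i
        fin_cases i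
        · exact h0
        · show 0 ≤ z 0 * z 1 ∧ z 0 * z 1 ≤ 1
          exact ⟨mul_nonneg h0.1 h1.1, by nlinarith⟩
      · show z 0 * z 1 - z 0 ≤ 0
        nlinarith
      · show (0:ℝ) < z 0
        exact hpos'
  refine KZ.changeOfVariablesRel_subset_relations ⟨2, Bq17P, W27TriP, Fib, Φ', ?_, ?_, ?_, hdom, ?_, rfl⟩
  · have hsd : IsSemialgebraic ℚ Bq17P.domain := Bq17P.isSemialgebraic_domain
    refine (isSemialgebraicMapOn_iff_forall_holds hsd).mpr fun i => ?_
    fin_cases i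
    · exact (isSemialgebraicFunOn_aeval hsd (X 0)).congr fun z _ => by
        simp only [Fib, Fin.zero_eta, Matrix.cons_val_zero, aeval_X]
    · exact (isSemialgebraicFunOn_aeval hsd (X 0 * X 1)).congr fun z _ => by
        simp only [Fib, Fin.mk_one, Matrix.cons_val_one, Matrix.head_cons, Matrix.cons_val_fin_one, map_mul,
          aeval_X]
  · intro z hz
    have hA := hasFDerivAt_apply (𝕜 := ℝ) 0 z
    have hB := hasFDerivAt_apply (𝕜 := ℝ) 1 z
    have h01 := hA.mul hB
    have hpi : HasFDerivAt Fib (Φ' z) z := by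
      rw [hasFDerivAt_pi']
      intro i
      fin_cases i
      · refine (hA.congr_fderiv ?_).congr_of_eventuallyEq (Filter.Eventually.of_forall fun y => ?_)
        · ext w
          simp [hΦ'ap]
        · simp only [Fin.zero_eta, Fib_zero]
      · refine (h01.congr_fderiv ?_).congr_of_eventuallyEq (Filter.Eventually.of_forall fun y => ?_)
        · ext w
          simp [hΦ'ap]
          ring
        · simp only [Fin.mk_one, Fib_one, Pi.mul_apply]
    exact hpi.hasFDerivWithinAt
  · intro z₁ hz₁ z₂ hz₂ heq
    have hz₁' : z₁ ∈ SqP0 := by simpa [Bq17P, KZ.IntegralRep.domain_restrict] using hz₁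
    have hpos : 0 < z₁ 0 := hz₁'.2
    have e0 : z₁ 0 = z₂ 0 := by simpa [Fib] using congrFun heq 0
    have e1 : z₁ 0 * z₁ 1 = z₂ 0 * z₂ 1 := by simpa [Fib] using congrFun heq 1
    rw [← e0] at e1
    have e1' := mul_left_cancel₀ hpos.ne' e1
    funext i
    fin_cases i
    · exact e0
    · exact e1'
  · intro z hz
    have hz' : z ∈ SqP0 := by simpa [Bq17P, KZ.IntegralRep.domain_restrict] using hz
    have h0 := (cube2 hz'.1).1
    have h1 := (cube2 hz'.1).2
    have hpos : 0 < z 0 := hz'.2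
    rw [hdet z, abs_of_pos hpos]
    simp only [Bq17P, W27TriP, W27Tri, KZ.IntegralRep.integrand_restrict, RFun.rep_integrand]
    simp only [Bq, BqDen, W27, W27Den, RFun.fn, Fib, map_add, map_sub, map_mul, aeval_C, aeval_X, eq_ratCast,
      Rat.cast_one, Rat.cast_ofNat, Rat.cast_mul, Rat.cast_div, vec2_0, vec2_1, Matrix.cons_val_zero,
      Matrix.cons_val_one, Matrix.head_cons]
    have ha : (0:ℝ) < 1 + 1 / 7 * z 0 * z 0 := by nlinarith [mul_nonneg h0.1 h0.1]
    have hb : (0:ℝ) < 1 + 1 / 7 * z 0 * z 0 * z 1 * z 1 := by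
      nlinarith [mul_nonneg (mul_nonneg h0.1 h0.1) (mul_nonneg h1.1 h1.1)]
    have hc : (0:ℝ) < 1 + 1 / 7 * (z 0 * z 1) * (z 0 * z 1) := by nlinarith [mul_self_nonneg (z 0 * z 1)]
    have hane := ha.ne'
    have hbne := hb.ne'
    have hcne := hc.ne'
    field_simp

/-- the linear scaling `(x,y) ↦ (x/7, y/7)`. -/
def Sc (z : Fin 2 → ℝ) : Fin 2 → ℝ := ![1 / 7 * z 0, 1 / 7 * z 1]
/-- Auxiliary step `Sc_zero` (§19v): Sc zero. [bookkeeping] -/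
theorem Sc_zero (z : Fin 2 → ℝ) : Sc z 0 = 1 / 7 * z 0 := rfl
/-- Auxiliary step `Sc_one` (§19v): Sc one. [bookkeeping] -/
theorem Sc_one (z : Fin 2 → ℝ) : Sc z 1 = 1 / 7 * z 1 := rfl

end Fold
end Summit.KontsevichZagierPeriods.RootDecompQuadraticDescent.Pair18Homotopy
end
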